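import Literature.Geometry.Symplectic.NearSymplecticTwoCirclesReduction
import Literature.Geometry.Symplectic.HondaModelNearSymplectic
import Literature.Geometry.Kaehler.ManifoldFormsPullback
import HarnessLib

/-!
# The axis of a Honda model chart is an even zero circle

Topic `Literature/Geometry/Symplectic` (groundwork `--supports`
`Literature.Geometry.Symplectic.relNearSymplecticTaubesTubes_exists`; everything here is PROVED,
no named fact is introduced).

`NearSymplecticTwoCirclesReduction.lean` reduced the named fact to two published statements, the
second being Honda's normal form theorem (Honda 2004, §4 Thm. 5; Perutz 2006, Lemma 3.1): a
near-symplectic form admits a Honda model chart `χ` (`IsHondaModelChartIn`, pulling the form back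
to the untwisted model `ω_A = hondaFormA`) along an EVEN zero circle.  This file proves the
converse ("only if") half of that theorem in the tree's vocabulary, which is also the consistency
check of the three definitions involved (`IsHondaModelChartIn`, `zeroNormalForm` /
`IsMinorityVector`, `IsEvenZeroCircle`):

* `zeroGradient_pullback_apply_of_eq_zero` — **the intrinsic gradient is natural at a zero**:
  for a smooth form `sf` on `M` vanishing at `χ q` and `χ : ℝ⁴ → M` smooth near `q`,
  `∇(χ^* sf)(q)(W)(v₁, v₂) = (∇sf)(χ q)(dχ W)(dχ v₁, dχ v₂)` (Perutz 2006, Def. 1.1: at a zero the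
  gradient of a section is intrinsic; here: chain rule in the chart at `χ q`, the term involving
  the second derivative of `χ` being multiplied by `sf (χ q) = 0`);
* `IsHondaModelChartIn.zeroGradient_apply_of_mem_hondaAxis` — along the axis of a Honda model
  chart, `(∇sf)(χ q)(dχ W)(dχ U, dχ V) = ω_A(W)(U, V)` (the model form is linear in the point, so
  it is its own gradient, `zeroGradient_hondaMForm`);
* `IsHondaModelChartIn.zeroNormalForm_axis` — hence Perutz's form `S(v, w) = (∇_v sf)(γ', w)` at
  the points of the axis circle `γ(θ) = χ(θ e_θ)` reads `diag(1, 1, −2)` (`untwistedNormalQuad`)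
  in the frame `dχ(∂₁, ∂₂, ∂₃)` (Perutz 2006, §2.3 with §2 eq. (2));
* `IsHondaModelChartIn.isZeroCircle_axis`, `IsHondaModelChartIn.isEvenZeroCircle_axis` — **the
  axis circle of a Honda model chart of positive radius for a smooth form is an even zero
  circle**: `dχ(∂₃)` is a continuous `2π`-periodic field of minority vectors along it (Perutz 2006,
  Prop. 2.2 and the paragraph after it: the untwisted model has even zero circle; Honda 2004, §4
  Thm. 5, "only if").

## References

* K. Honda, *Local properties of self-dual harmonic 2-forms on a 4-manifold*, J. reine angew.
  Math. 577 (2004), §4 Thm. 5 [Honda2004LocalSD].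
* T. Perutz, *Zero-sets of near-symplectic forms*, J. Symplectic Geom. 4 (2006), Def. 1.1, §2.3,
  Prop. 2.2, Lemma 3.1 [Perutz2006].
-/

noncomputable section

open scoped Manifold ContDiff Topology Real
open Set Function Filter Bundle Literature.Geometry.Kaehler

namespace Literature.Geometry.Symplectic

/-- Local notation for the model space `ℝ⁴ = EuclideanSpace ℝ (Fin 4)`. -/
local notation "E4" => EuclideanSpace ℝ (Fin 4)

/-! ### Naturality of the gradient at a zero -/

section Gradient

variable {M : Type*} [TopologicalSpace M] [ChartedSpace E4 M]

/-- From the flat source `ℝ⁴`, `mfderiv` of `χ` at `q` is the Fréchet derivative at `q` of `χ`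
written in the chart at `χ q`. [folklore] -/
theorem mfderiv_eq_fderiv_extChartAt_comp {χ : E4 → M} {q : E4}
    (hχ : MDifferentiableAt 𝓘(ℝ, E4) (𝓡 4) χ q) :
    mfderiv 𝓘(ℝ, E4) (𝓡 4) χ q = fderiv ℝ (writtenInExtChartAt 𝓘(ℝ, E4) (𝓡 4) q χ) q := by
  rw [hχ.mfderiv]
  simp only [modelWithCornersSelf_coe, range_id, fderivWithin_univ, extChartAt_model_space_eq_id,
    PartialEquiv.refl_coe, id_eq]

/-- The written map from the flat source sends `q` to the centre of the chart at `χ q`.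
[folklore] -/
theorem writtenInExtChartAt_flat_apply_self (χ : E4 → M) (q : E4) :
    writtenInExtChartAt 𝓘(ℝ, E4) (𝓡 4) q χ q = extChartAt (𝓡 4) (χ q) (χ q) := by
  simp only [writtenInExtChartAt, comp_apply, extChartAt_model_space_eq_id, PartialEquiv.refl_symm,
    PartialEquiv.refl_coe, id_eq]

variable [IsManifold (𝓡 4) ∞ M]

/-- **The intrinsic gradient is natural at a zero** (Perutz 2006, Def. 1.1: at a zero of a smooth
section its gradient is intrinsic).  For `χ : ℝ⁴ → M` smooth near `q` and a form `sf` smooth at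
`χ q` with `sf (χ q) = 0`, the chart gradient of the pull-back `χ^* sf` at `q` is the chart
gradient of `sf` at `χ q` transported by `dχ_q` in all three slots:
`∇(χ^* sf)(q)(W)(v₀, v₁) = (∇sf)(χ q)(dχ_q W)(dχ_q v₀, dχ_q v₁)`.  (Chain rule for
`(χ^* sf) = (sf.inChart (χ q) ∘ g) ∘ (Dg)^{⊗2}`, `g` the written map; the term with `D²g` carries
the factor `sf (χ q) = 0`.) [cite: Perutz2006, Def. 1.1] -/
theorem zeroGradient_pullback_apply_of_eq_zero {sf : MForm (𝓡 4) M ℝ 2} {χ : E4 → M} {q : E4}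
    (hχ : ∀ᶠ z in 𝓝 q, ContMDiffAt 𝓘(ℝ, E4) (𝓡 4) ∞ χ z) (hsf : sf.SmoothAt (χ q))
    (h0 : sf (χ q) = 0) (W : E4) (v : Fin 2 → E4) :
    zeroGradient (sf.pullback 𝓘(ℝ, E4) χ) q W v =
      zeroGradient sf (χ q) (mfderiv 𝓘(ℝ, E4) (𝓡 4) χ q W)
        (fun i => mfderiv 𝓘(ℝ, E4) (𝓡 4) χ q (v i)) := by
  have hχq : ContMDiffAt 𝓘(ℝ, E4) (𝓡 4) ∞ χ q := hχ.self_of_nhds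
  have hχd : MDifferentiableAt 𝓘(ℝ, E4) (𝓡 4) χ q := hχq.mdifferentiableAt (by simp)
  -- (1) the chart representative of the pull-back near `q`
  have hev₀ := MForm.inChart_pullback_eventuallyEq (I := 𝓘(ℝ, E4)) (I' := 𝓡 4) (x := q) sf
    (hχ.mono fun z hz => hz.mdifferentiableAt (by simp))
  simp only [modelWithCornersSelf_coe, range_id, nhdsWithin_univ, fderivWithin_univ,
    extChartAt_model_space_eq_id, PartialEquiv.refl_coe, id_eq] at hev₀
  set g : E4 → E4 := writtenInExtChartAt 𝓘(ℝ, E4) (𝓡 4) q χ with hg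
  have hgq : g q = extChartAt (𝓡 4) (χ q) (χ q) := writtenInExtChartAt_flat_apply_self χ q
  -- (2) smoothness of the written map and of the chart representative of `sf`
  have hgs : ContDiffAt ℝ ∞ g q := by
    have h2 := (contMDiffAt_iff.1 hχq).2
    simp only [modelWithCornersSelf_coe, range_id, extChartAt_model_space_eq_id,
      PartialEquiv.refl_coe, id_eq] at h2
    exact h2.contDiffAt univ_mem
  have hA : HasFDerivAt (fun y => sf.inChart (χ q) (g y))
      ((zeroGradient sf (χ q)).comp (fderiv ℝ g q)) q := by
    have hs : ContDiffAt ℝ ∞ (sf.inChart (χ q)) (extChartAt (𝓡 4) (χ q) (χ q)) := by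
      have hs' : ContDiffWithinAt ℝ ∞ (sf.inChart (χ q)) (range (𝓡 4))
          (extChartAt (𝓡 4) (χ q) (χ q)) := hsf
      simp only [modelWithCornersSelf_coe, range_id] at hs'
      exact hs'.contDiffAt univ_mem
    have hs₁ : HasFDerivAt (sf.inChart (χ q)) (zeroGradient sf (χ q)) (g q) := by
      rw [hgq]
      exact (hs.differentiableAt (by simp)).hasFDerivAt
    exact hs₁.comp q (hgs.differentiableAt (by simp)).hasFDerivAt
  have hL : HasFDerivAt (fun y => fderiv ℝ g y) (fderiv ℝ (fderiv ℝ g) q) q :=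
    ((hgs.fderiv_right (m := ∞) (by simp)).differentiableAt (by simp)).hasFDerivAt
  have hR := hA.continuousAlternatingMapCompContinuousLinearMap hL
  -- (3) the chart representative of `sf` vanishes at the centre, so the `D²g`-term drops out
  have hz : sf.inChart (χ q) (g q) = 0 := by
    rw [hgq, MForm.inChart_apply_self]
    exact h0
  have hz' : (sf.inChart (χ q) (g q)).fderivCompContinuousLinearMap (fderiv ℝ g q) = 0 := by
    ext dg w
    simp [hz, ContinuousAlternatingMap.fderivCompContinuousLinearMap_apply]
  rw [hz', ContinuousLinearMap.zero_comp, add_zero] at hR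
  -- (4) assemble
  have hgrad : zeroGradient (sf.pullback 𝓘(ℝ, E4) χ) q =
      fderiv ℝ (fun y => (sf.inChart (χ q) (g y)).compContinuousLinearMap (fderiv ℝ g y)) q := by
    unfold zeroGradient
    rw [show extChartAt 𝓘(ℝ, E4) q q = q by simp]
    exact hev₀.fderiv_eq
  rw [hgrad, hR.fderiv, mfderiv_eq_fderiv_extChartAt_comp hχd, ← hg]
  rfl

end Gradient

/-! ### The gradient along the axis of a Honda model chart -/

namespace IsHondaModelChartIn

variable {M : Type*} [TopologicalSpace M] [ChartedSpace E4 M]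
  {N : Set M} {r : ℝ} {sf : MForm (𝓡 4) M ℝ 2} {χ : E4 → M}

/-- `χ` is smooth at every point of the (open) model tube. [folklore] -/
theorem contMDiffAt (h : IsHondaModelChartIn N r sf χ) {q : E4} (hq : q ∈ hondaTube r) :
    ContMDiffAt 𝓘(ℝ, E4) (𝓡 4) ∞ χ q :=
  h.contMDiffOn.contMDiffAt ((isOpen_hondaTube r).mem_nhds hq)

/-- `χ` is smooth near every point of the model tube. [folklore] -/
theorem eventually_contMDiffAt (h : IsHondaModelChartIn N r sf χ) {q : E4}
    (hq : q ∈ hondaTube r) : ∀ᶠ z in 𝓝 q, ContMDiffAt 𝓘(ℝ, E4) (𝓡 4) ∞ χ z := by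
  filter_upwards [(isOpen_hondaTube r).mem_nhds hq] with z hz
  exact h.contMDiffAt hz

/-- On the model tube `dχ_q` is onto (an injective linear endomorphism of `ℝ⁴`). [folklore] -/
theorem surjective_mfderiv (h : IsHondaModelChartIn N r sf χ) {q : E4} (hq : q ∈ hondaTube r) :
    Surjective (mfderiv 𝓘(ℝ, E4) (𝓡 4) χ q) :=
  (LinearMap.injective_iff_surjective
    (f := (mfderiv 𝓘(ℝ, E4) (𝓡 4) χ q).toLinearMap)).1 (h.injective_mfderiv q hq)

/-- **The derivative of `χ` is `2π e_θ`-periodic on the model tube** (chain rule applied to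
`χ ∘ (· + 2π e_θ) = χ`). [folklore] -/
theorem mfderiv_add_two_pi (h : IsHondaModelChartIn N r sf χ) {q : E4} (hq : q ∈ hondaTube r) :
    mfderiv 𝓘(ℝ, E4) (𝓡 4) χ (q + (2 * π) • EuclideanSpace.single 0 1) =
      mfderiv 𝓘(ℝ, E4) (𝓡 4) χ q := by
  set v : E4 := (2 * π) • EuclideanSpace.single 0 1 with hv
  have hper : χ ∘ (fun x : E4 => x + v) = χ := funext fun x => h.periodic x
  have hq' : q + v ∈ hondaTube r := add_smul_single_mem_hondaTube hq _
  have hχ : MDifferentiableAt 𝓘(ℝ, E4) (𝓡 4) χ (q + v) :=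
    (h.contMDiffAt hq').mdifferentiableAt (by simp)
  have hτ : HasMFDerivAt 𝓘(ℝ, E4) 𝓘(ℝ, E4) (fun x : E4 => x + v) q
      (ContinuousLinearMap.id ℝ E4) :=
    ((hasFDerivAt_id q).add_const v).hasMFDerivAt
  have hc := hχ.hasMFDerivAt.comp q hτ
  rw [hper] at hc
  ext1 u
  exact (DFunLike.congr_fun hc.mfderiv u).symm

/-- **On the model tube, `χ^* sf` is the model form `Θ = hondaMForm`** (germ at `q`).
[cite: Honda2004LocalSD, §4 Thm. 4 (A)] -/
theorem pullback_eventuallyEq_hondaMForm (h : IsHondaModelChartIn N r sf χ) {q : E4}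
    (hq : q ∈ hondaTube r) :
    ∀ᶠ y in 𝓝 q, (sf.pullback 𝓘(ℝ, E4) χ) y = hondaMForm y := by
  filter_upwards [(isOpen_hondaTube r).mem_nhds hq] with y hy
  ext v
  have hv : (fun i => mfderiv 𝓘(ℝ, E4) (𝓡 4) χ y (v i)) =
      ![mfderiv 𝓘(ℝ, E4) (𝓡 4) χ y (v 0), mfderiv 𝓘(ℝ, E4) (𝓡 4) χ y (v 1)] := by
    funext i; fin_cases i <;> rfl
  rw [MForm.pullback_apply, hv, h.pullback_eq y hy]
  change hondaFormA y (v 0) (v 1) = hondaFormCLM y v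
  rw [hondaFormCLM_apply']

/-- **The gradient of `χ^* sf` on the model tube is the model gradient `ω_A(·)`**.
[cite: Perutz2006, §2 eq. (2)] -/
theorem zeroGradient_pullback (h : IsHondaModelChartIn N r sf χ) {q : E4} (hq : q ∈ hondaTube r) :
    zeroGradient (sf.pullback 𝓘(ℝ, E4) χ) q = hondaFormCLM := by
  rw [zeroGradient_congr_of_eventuallyEq (h.pullback_eventuallyEq_hondaMForm hq),
    zeroGradient_hondaMForm]

/-- The axis lies in every model tube of positive radius. [folklore] -/
theorem hondaAxis_subset (hr : 0 < r) : hondaAxis ⊆ hondaTube r :=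
  hondaAxis_subset_hondaTube hr

/-- **`sf` vanishes along the image of the axis**: `sf (χ q)(dχ U, dχ V) = ω_A(q)(U, V) = 0` for
`q` on the axis, and `dχ_q` is onto. [cite: Honda2004LocalSD, §4 Thm. 4 (A)] -/
theorem apply_eq_zero_of_mem_hondaAxis (h : IsHondaModelChartIn N r sf χ) (hr : 0 < r) {q : E4}
    (hq : q ∈ hondaAxis) : sf (χ q) = 0 := by
  have hqt : q ∈ hondaTube r := hondaAxis_subset_hondaTube hr hq
  ext v
  obtain ⟨U, hU⟩ := h.surjective_mfderiv hqt (v 0)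
  obtain ⟨V, hV⟩ := h.surjective_mfderiv hqt (v 1)
  have hv : v = ![mfderiv 𝓘(ℝ, E4) (𝓡 4) χ q U, mfderiv 𝓘(ℝ, E4) (𝓡 4) χ q V] := by
    funext i; fin_cases i
    · exact hU.symm
    · exact hV.symm
  rw [hv, h.pullback_eq q hqt, hondaFormA_eq_zero_of_mem_hondaAxis hq]
  rfl

/-- The image of the axis lies in the zero locus. [cite: Honda2004LocalSD, §4 Thm. 4 (A)] -/
theorem image_hondaAxis_subset_zeroLocus (h : IsHondaModelChartIn N r sf χ) (hr : 0 < r) :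
    χ '' hondaAxis ⊆ zeroLocus sf := by
  rintro _ ⟨q, hq, rfl⟩
  exact h.apply_eq_zero_of_mem_hondaAxis hr hq

variable [IsManifold (𝓡 4) ∞ M]

/-- **The intrinsic gradient along the axis of a Honda model chart**: for `q` on the axis and a
form smooth at `χ q`, `(∇sf)(χ q)(dχ_q W)(dχ_q U, dχ_q V) = ω_A(W)(U, V)` (naturality of the
gradient at the zero `χ q`, and `∇(χ^* sf) = ∇Θ = ω_A(·)`). [cite: Perutz2006, §2 eq. (2)] -/
theorem zeroGradient_apply_of_mem_hondaAxis (h : IsHondaModelChartIn N r sf χ) (hr : 0 < r)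
    {q : E4} (hq : q ∈ hondaAxis) (hsf : sf.SmoothAt (χ q)) (W U V : E4) :
    zeroGradient sf (χ q) (mfderiv 𝓘(ℝ, E4) (𝓡 4) χ q W)
        ![mfderiv 𝓘(ℝ, E4) (𝓡 4) χ q U, mfderiv 𝓘(ℝ, E4) (𝓡 4) χ q V] = hondaFormA W U V := by
  have hqt : q ∈ hondaTube r := hondaAxis_subset_hondaTube hr hq
  have key := zeroGradient_pullback_apply_of_eq_zero (h.eventually_contMDiffAt hqt) hsf
    (h.apply_eq_zero_of_mem_hondaAxis hr hq) W ![U, V]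
  have hv : (fun i => mfderiv 𝓘(ℝ, E4) (𝓡 4) χ q (![U, V] i)) =
      ![mfderiv 𝓘(ℝ, E4) (𝓡 4) χ q U, mfderiv 𝓘(ℝ, E4) (𝓡 4) χ q V] := by
    funext i; fin_cases i <;> rfl
  rw [hv, h.zeroGradient_pullback hqt, hondaFormCLM_apply] at key
  exact key.symm

end IsHondaModelChartIn

/-! ### The axis circle -/

section AxisDefs

variable {M : Type*}

/-- The point `θ e_θ` of the axis of `ℝ_θ × ℝ³`. [folklore] -/
def hondaAxisPoint (θ : ℝ) : E4 :=
  θ • EuclideanSpace.single 0 1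

/-- `θ e_θ` lies on the axis. [folklore] -/
theorem hondaAxisPoint_mem_hondaAxis (θ : ℝ) : hondaAxisPoint θ ∈ hondaAxis := by
  simp [hondaAxisPoint, mem_hondaAxis]

/-- `(θ + 2π) e_θ = θ e_θ + 2π e_θ`. [folklore] -/
theorem hondaAxisPoint_add_two_pi (θ : ℝ) :
    hondaAxisPoint (θ + 2 * π) = hondaAxisPoint θ + (2 * π) • EuclideanSpace.single 0 1 := by
  simp [hondaAxisPoint, add_smul]

/-- The `θ`-coordinate of `θ e_θ` is `θ`. [folklore] -/
@[simp] theorem hondaAxisPoint_apply_zero (θ : ℝ) : hondaAxisPoint θ 0 = θ := by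
  simp [hondaAxisPoint]

/-- `θ ↦ θ e_θ` is smooth. [folklore] -/
theorem contMDiff_hondaAxisPoint : ContMDiff 𝓘(ℝ, ℝ) 𝓘(ℝ, E4) ∞ hondaAxisPoint :=
  contMDiff_iff_contDiff.2 (contDiff_id.smul contDiff_const)

/-- The derivative of `θ ↦ θ e_θ`: `t ↦ t e_θ`. [folklore] -/
theorem hasMFDerivAt_hondaAxisPoint (θ : ℝ) :
    HasMFDerivAt 𝓘(ℝ, ℝ) 𝓘(ℝ, E4) hondaAxisPoint θ
      ((ContinuousLinearMap.id ℝ ℝ).smulRight (EuclideanSpace.single 0 1)) :=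
  ((hasFDerivAt_id θ).smul_const (EuclideanSpace.single (0 : Fin 4) (1 : ℝ))).hasMFDerivAt

/-- **The axis circle `γ(θ) = χ(θ e_θ)` of a chart `χ : ℝ_θ × ℝ³ → M`.** [folklore] -/
def hondaAxisCircle (χ : E4 → M) (θ : ℝ) : M :=
  χ (hondaAxisPoint θ)

/-- Unfolding `hondaAxisCircle`. [folklore] -/
theorem hondaAxisCircle_apply (χ : E4 → M) (θ : ℝ) :
    hondaAxisCircle χ θ = χ (hondaAxisPoint θ) :=
  rfl

/-- The range of the axis circle is the image of the axis. [folklore] -/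
theorem range_hondaAxisCircle (χ : E4 → M) : range (hondaAxisCircle χ) = χ '' hondaAxis := by
  ext x
  constructor
  · rintro ⟨θ, rfl⟩
    exact ⟨hondaAxisPoint θ, hondaAxisPoint_mem_hondaAxis θ, rfl⟩
  · rintro ⟨q, hq, rfl⟩
    refine ⟨q 0, ?_⟩
    rw [hondaAxisCircle_apply]
    congr 1
    rw [mem_hondaAxis] at hq
    refine LegendrianDarboux.euclidean_four_ext ?_ ?_ ?_ ?_ <;>
      simp [hondaAxisPoint, hq.1, hq.2.1, hq.2.2]

end AxisDefs

section Axis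

variable {M : Type*} [TopologicalSpace M] [ChartedSpace E4 M]
  {N : Set M} {r : ℝ} {sf : MForm (𝓡 4) M ℝ 2} {χ : E4 → M}

namespace IsHondaModelChartIn

/-- **The derivative of the axis circle**: `dγ_θ = dχ_{θ e_θ} ∘ (t ↦ t e_θ)`. [folklore] -/
theorem hasMFDerivAt_hondaAxisCircle (h : IsHondaModelChartIn N r sf χ) (hr : 0 < r) (θ : ℝ) :
    HasMFDerivAt 𝓘(ℝ, ℝ) (𝓡 4) (hondaAxisCircle χ) θ
      ((mfderiv 𝓘(ℝ, E4) (𝓡 4) χ (hondaAxisPoint θ)).comp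
        ((ContinuousLinearMap.id ℝ ℝ).smulRight (EuclideanSpace.single 0 1))) := by
  have hq : hondaAxisPoint θ ∈ hondaTube r :=
    hondaAxis_subset_hondaTube hr (hondaAxisPoint_mem_hondaAxis θ)
  have hχ : MDifferentiableAt 𝓘(ℝ, E4) (𝓡 4) χ (hondaAxisPoint θ) :=
    (h.contMDiffAt hq).mdifferentiableAt (by simp)
  exact hχ.hasMFDerivAt.comp θ (hasMFDerivAt_hondaAxisPoint θ)

/-- **The tangent of the axis circle is `dχ(e_θ)`.** [folklore] -/
theorem zeroCircleTangent_hondaAxisCircle (h : IsHondaModelChartIn N r sf χ) (hr : 0 < r)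
    (θ : ℝ) :
    zeroCircleTangent (hondaAxisCircle χ) θ =
      mfderiv 𝓘(ℝ, E4) (𝓡 4) χ (hondaAxisPoint θ) (EuclideanSpace.single 0 1) := by
  rw [zeroCircleTangent, (h.hasMFDerivAt_hondaAxisCircle hr θ).mfderiv]
  exact congrArg (mfderiv 𝓘(ℝ, E4) (𝓡 4) χ (hondaAxisPoint θ))
    (one_smul ℝ (EuclideanSpace.single (0 : Fin 4) (1 : ℝ)))

/-- **The axis circle of a Honda model chart of positive radius is a zero circle** (smooth,
`2π`-periodic, immersed, injective mod `2πℤ`, inside `Z_sf`). [cite: Perutz2006, Lemma 1.2] -/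
theorem isZeroCircle_axis (h : IsHondaModelChartIn N r sf χ) (hr : 0 < r) :
    IsZeroCircle sf (hondaAxisCircle χ) where
  periodic θ := by
    rw [hondaAxisCircle_apply, hondaAxisCircle_apply, hondaAxisPoint_add_two_pi, h.periodic]
  contMDiff θ :=
    (h.contMDiffAt (hondaAxis_subset_hondaTube hr (hondaAxisPoint_mem_hondaAxis θ))).comp θ
      (contMDiff_hondaAxisPoint θ)
  injective_mfderiv θ := by
    rw [(h.hasMFDerivAt_hondaAxisCircle hr θ).mfderiv]
    have hinj := h.injective_mfderiv _
      (hondaAxis_subset_hondaTube hr (hondaAxisPoint_mem_hondaAxis θ))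
    have hne : (EuclideanSpace.single (0 : Fin 4) (1 : ℝ) : E4) ≠ 0 := by simp
    have hc : Injective
        ((ContinuousLinearMap.id ℝ ℝ).smulRight (EuclideanSpace.single (0 : Fin 4) (1 : ℝ))) :=
      fun a b hab => smul_left_injective ℝ hne (by simpa using hab)
    exact hinj.comp hc
  eq_add_of_eq θ θ' hθ := by
    obtain ⟨k, hk⟩ := h.eq_add_of_eq (hondaAxisPoint θ)
      (hondaAxis_subset_hondaTube hr (hondaAxisPoint_mem_hondaAxis θ)) (hondaAxisPoint θ')
      (hondaAxis_subset_hondaTube hr (hondaAxisPoint_mem_hondaAxis θ')) hθ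
    refine ⟨k, ?_⟩
    have := congrArg (fun q : E4 => q 0) hk
    simpa [hondaAxisPoint] using this
  mem_zeroLocus θ := h.apply_eq_zero_of_mem_hondaAxis hr (hondaAxisPoint_mem_hondaAxis θ)

variable [IsManifold (𝓡 4) ∞ M]

/-- **Perutz's form along the axis circle is `diag(1, 1, −2)` in the frame `dχ(∂₁, ∂₂, ∂₃)`**:
`S_{γ(θ), γ'(θ)}(dχ V, dχ W) = ω_A(V)(e_θ, W) = V₁W₁ + V₂W₂ − 2V₃W₃` (Perutz 2006, §2.3 with
§2 eq. (2): the untwisted model). [cite: Perutz2006, §2.3 (c)] -/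
theorem zeroNormalForm_axis (h : IsHondaModelChartIn N r sf χ) (hr : 0 < r)
    (hsf : IsSmoothForm sf) (θ : ℝ) (V W : E4) :
    zeroNormalForm sf (hondaAxisCircle χ θ) (zeroCircleTangent (hondaAxisCircle χ) θ)
        (mfderiv 𝓘(ℝ, E4) (𝓡 4) χ (hondaAxisPoint θ) V)
        (mfderiv 𝓘(ℝ, E4) (𝓡 4) χ (hondaAxisPoint θ) W) = untwistedNormalQuad V W := by
  rw [zeroNormalForm_apply, h.zeroCircleTangent_hondaAxisCircle hr, hondaAxisCircle_apply,
    h.zeroGradient_apply_of_mem_hondaAxis hr (hondaAxisPoint_mem_hondaAxis θ)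
      ((isSmoothForm_iff_smoothAt sf).1 hsf _)]
  simp [hondaFormA, hondaDQ, untwistedNormalQuad]
  ring

/-- **`dχ(∂₃)` is a minority vector of Perutz's form along the axis circle.**
[cite: Perutz2006, §2.3 (d)] -/
theorem isMinorityVector_axis (h : IsHondaModelChartIn N r sf χ) (hr : 0 < r)
    (hsf : IsSmoothForm sf) (θ : ℝ) :
    IsMinorityVector
      (zeroNormalForm sf (hondaAxisCircle χ θ) (zeroCircleTangent (hondaAxisCircle χ) θ))
      (mfderiv 𝓘(ℝ, E4) (𝓡 4) χ (hondaAxisPoint θ) (EuclideanSpace.single 3 1)) := by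
  have hqt : hondaAxisPoint θ ∈ hondaTube r :=
    hondaAxis_subset_hondaTube hr (hondaAxisPoint_mem_hondaAxis θ)
  have hm := isMinorityVector_untwistedNormalQuad_e3
  refine ⟨?_, fun w => ?_⟩
  · rw [h.zeroNormalForm_axis hr hsf]
    exact hm.ne_zero
  · obtain ⟨W', hW'⟩ := h.surjective_mfderiv hqt w
    have hw : w = mfderiv 𝓘(ℝ, E4) (𝓡 4) χ (hondaAxisPoint θ) W' := hW'.symm
    rw [hw, h.zeroNormalForm_axis hr hsf, h.zeroNormalForm_axis hr hsf,
      h.zeroNormalForm_axis hr hsf]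
    exact hm.mul_le_sq W'

/-- **The field `dχ(∂₃)` along the axis circle is continuous** (in the tangent bundle of `M`):
it is the bundled derivative `Tχ` of `χ` composed with the continuous section
`θ ↦ (θ e_θ, ∂₃)` of `Tℝ⁴ = ℝ⁴ × ℝ⁴`. [folklore] -/
theorem continuous_axisSection (h : IsHondaModelChartIn N r sf χ) (hr : 0 < r) (e : E4) :
    Continuous fun θ : ℝ =>
      (TotalSpace.mk' E4 (hondaAxisCircle χ θ)
        (mfderiv 𝓘(ℝ, E4) (𝓡 4) χ (hondaAxisPoint θ) e) : TangentBundle (𝓡 4) M) := by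
  have hmem : ∀ θ : ℝ, hondaAxisPoint θ ∈ hondaTube r := fun θ =>
    hondaAxis_subset_hondaTube hr (hondaAxisPoint_mem_hondaAxis θ)
  -- the continuous section `θ ↦ (θ e_θ, e)` of the (trivial) tangent bundle of `ℝ⁴`
  set s : ℝ → TangentBundle 𝓘(ℝ, E4) E4 := fun θ => TotalSpace.mk' E4 (hondaAxisPoint θ) e
    with hs_def
  have hs : Continuous s := by
    have hs' : s = (tangentBundleModelSpaceHomeomorph 𝓘(ℝ, E4)).symm ∘
        fun θ => (hondaAxisPoint θ, e) := rfl
    rw [hs']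
    exact (tangentBundleModelSpaceHomeomorph 𝓘(ℝ, E4)).symm.continuous.comp
      ((contMDiff_iff_contDiff.1 contMDiff_hondaAxisPoint).continuous.prodMk continuous_const)
  -- the bundled derivative of `χ` within the tube is continuous over the tube
  have hF : ContinuousOn (tangentMapWithin 𝓘(ℝ, E4) (𝓡 4) χ (hondaTube r))
      (TotalSpace.proj ⁻¹' hondaTube r) :=
    h.contMDiffOn.continuousOn_tangentMapWithin (by simp) (isOpen_hondaTube r).uniqueMDiffOn
  have hcomp : Continuous (tangentMapWithin 𝓘(ℝ, E4) (𝓡 4) χ (hondaTube r) ∘ s) :=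
    hF.comp_continuous hs fun θ => hmem θ
  have heq : (fun θ : ℝ => (TotalSpace.mk' E4 (hondaAxisCircle χ θ)
      (mfderiv 𝓘(ℝ, E4) (𝓡 4) χ (hondaAxisPoint θ) e) : TangentBundle (𝓡 4) M)) =
      tangentMapWithin 𝓘(ℝ, E4) (𝓡 4) χ (hondaTube r) ∘ s := by
    funext θ
    simp only [comp_apply, tangentMapWithin, hs_def,
      mfderivWithin_of_isOpen (isOpen_hondaTube r) (hmem θ)]
    rfl
  rw [heq]
  exact hcomp

/-- **The axis circle of a Honda model chart is an EVEN zero circle** (Perutz 2006, Prop. 2.2 and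
the paragraph after it: the untwisted model `S¹ × ℝ³`, `Θ = x₁β₁ + x₂β₂ − 2x₃β₃`, has an even zero
circle; equivalently the "only if" half of Honda 2004, §4 Thm. 5).  The witness is the continuous
`2π`-periodic field `θ ↦ dχ_{θ e_θ}(∂₃)` of minority vectors of `S_{γ(θ), γ'(θ)}`.
[cite: Perutz2006, Prop. 2.2] -/
theorem isEvenZeroCircle_axis (h : IsHondaModelChartIn N r sf χ) (hr : 0 < r)
    (hsf : IsSmoothForm sf) : IsEvenZeroCircle sf (hondaAxisCircle χ) := by
  refine ⟨h.isZeroCircle_axis hr,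
    fun θ => mfderiv 𝓘(ℝ, E4) (𝓡 4) χ (hondaAxisPoint θ) (EuclideanSpace.single 3 1),
    fun θ => ?_, h.continuous_axisSection hr _, fun θ => h.isMinorityVector_axis hr hsf θ⟩
  have hper := h.mfderiv_add_two_pi
    (hondaAxis_subset_hondaTube hr (hondaAxisPoint_mem_hondaAxis θ))
  rw [← hondaAxisPoint_add_two_pi] at hper
  exact DFunLike.congr_fun hper _

/-- **Necessity of evenness in Honda's normal form theorem**, in the shape of hypothesis (H) of
`relNearSymplecticTaubesTubes_exists_of_twoEvenCircles_of_hondaNormalForm`: if a smooth form has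
a Honda model chart `χ` of positive radius, then the axis circle of `χ` — whose range is
`χ(ℝ × 0)` — is an even zero circle of it (Honda 2004, §4 Thm. 5, "only if"; Perutz 2006,
Lemma 3.1). [cite: Honda2004LocalSD, §4 Thm. 5] -/
theorem exists_isEvenZeroCircle (h : IsHondaModelChartIn N r sf χ) (hr : 0 < r)
    (hsf : IsSmoothForm sf) :
    ∃ γ : ℝ → M, IsEvenZeroCircle sf γ ∧ range γ = χ '' hondaAxis ∧ range γ ⊆ N :=
  ⟨hondaAxisCircle χ, h.isEvenZeroCircle_axis hr hsf, range_hondaAxisCircle χ,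
    (range_hondaAxisCircle χ).symm ▸
      (image_mono (hondaAxis_subset_hondaTube hr)).trans h.image_subset⟩

end IsHondaModelChartIn

end Axis

end Literature.Geometry.Symplectic

end
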